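import Mathlib

/-!
# Apex cliques: a signed clique count for multipartite graphs (DEQ-A07)

HONEST FRAMING: instance-level adjudication of specific advantage claims; no claim about
BQP vs BPP or the summit.

Context (cell pub-qadeq, claim A-07 = Berry et al., arXiv:2209.13581v3 = PRX Quantum 5,
010319 (2024), §4.1: the clique complex of the complete `k`-partite graph `K(m,k)` has
`β_{k-1} = (m-1)^k`).  DEQ-A07.md (unit pub-qadeq-deq-1) treats the perturbed family
`K(m,k) - D` and proves (Theorem B there, via the Marietti–Testa splitting of independence
complexes) that when every part keeps an *apex* — a vertex adjacent to everything outside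
its part — the clique complex is a wedge of `N` spheres of dimension `k-1`, where `N` is the
number of `k`-cliques containing no apex.  Theorem B is NOT formalised here (no simplicial
homology is used); this file proves, sorry-free, its combinatorial shadow:

* `signed_clique_count` (Proposition C of DEQ-A07.md): for a `k`-partite graph on
  `Fin k × Fin (m+1)` with independent parts in which every `(a,0)` is an apex,
  `Σ_{S clique} (-1)^|S| = (-1)^k · #{cliques meeting every part in a non-apex vertex}`,
  by an explicit sign-reversing involution (toggle the apex of the first part in which the
  clique has no non-apex vertex); `full_cliques_eq` identifies those cliques with the
  `k`-vertex cliques containing no apex.  This is the identity that makes the Euler-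
  characteristic Monte Carlo estimator and the apex-transversal estimator of DEQ-A07 agree.
* `alternating_clique_count_complete_multipartite`: the unperturbed instance
  `Σ_j (-1)^(k-j) C(k,j) m^j = (m-1)^k` (binomial theorem), and an `ℕ`-valued form.
* `chernoff_budget`: the sample-count arithmetic `3 log(2/δ) ≤ T ρ₀ r² ⇒ both Chernoff
  tails ≤ δ/2` used for the `(r, δ)` guarantee of the apex-transversal estimator.

Everything is `[folklore]`-level finite combinatorics / arithmetic; no named fact, no axiom.
-/

namespace Literature.Computability.QuantumAlgorithms.ApexCliqueCount

open Finset BigOperators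

/-! ## The apex involution (DEQ-A07 Proposition C)

Vertices are `Fin k × Fin (m+1)`: `k` parts of size `m+1`; the vertex `(a,0)` is the
designated apex of part `a`.  A graph is a Boolean adjacency `adj`; the hypotheses used
below are: no edges inside a part (`nopart`), every apex is adjacent to every vertex of
every other part (`apex`), and symmetry.  For such a graph the signed count of cliques
`Σ_{S clique} (-1)^|S|` equals `(-1)^k` times the number of cliques meeting every part in
a non-apex vertex (equivalently: `k`-cliques containing no apex).  All statements proved. -/

section Involution

variable {k m : ℕ}

/-- `[folklore]` vertices: (part, position); position `0` is the apex of the part -/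
abbrev Vx (k m : ℕ) := Fin k × Fin (m + 1)

variable (adj : Vx k m → Vx k m → Bool)

/-- `[folklore]` `S` is a clique of `adj` -/
def IsClique (S : Finset (Vx k m)) : Prop := ∀ u ∈ S, ∀ v ∈ S, u ≠ v → adj u v = true

/-- `[folklore]` instDecIsClique (decidability / bookkeeping for the apex involution). -/
instance instDecIsClique (S : Finset (Vx k m)) : Decidable (IsClique adj S) := by
  unfold IsClique; infer_instance

/-- `[folklore]` all cliques (as vertex sets, including `∅`) -/
def cliques : Finset (Finset (Vx k m)) := Finset.univ.filter (fun S => IsClique adj S)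

/-- `[folklore]` parts in which `S` has no non-apex vertex -/
def badParts (S : Finset (Vx k m)) : Finset (Fin k) :=
  Finset.univ.filter (fun a => ∀ v ∈ S, v.1 = a → v.2 = 0)

/-- `[folklore]` `S` meets every part in a non-apex vertex -/
def Full (S : Finset (Vx k m)) : Prop := ∀ a : Fin k, ∃ v ∈ S, v.1 = a ∧ v.2 ≠ 0

/-- `[folklore]` instDecFull (decidability / bookkeeping for the apex involution). -/
instance instDecFull (S : Finset (Vx k m)) : Decidable (Full S) := by
  unfold Full; infer_instance

/-- `[folklore]` add `x` if absent, remove it if present -/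
def toggle (S : Finset (Vx k m)) (x : Vx k m) : Finset (Vx k m) :=
  if x ∈ S then S.erase x else insert x S

/-- `[folklore]` the involution: toggle the apex of the first bad part (identity if there is none) -/
def invol (S : Finset (Vx k m)) : Finset (Vx k m) :=
  if h : (badParts S).Nonempty then toggle S ((badParts S).min' h, 0) else S

/-- `[folklore]` auxiliary lemma `mem_badParts` for the apex involution. -/
lemma mem_badParts {S : Finset (Vx k m)} {a : Fin k} :
    a ∈ badParts S ↔ ∀ v ∈ S, v.1 = a → v.2 = 0 := by
  simp [badParts]

/-- `[folklore]` auxiliary lemma `badParts_nonempty_iff` for the apex involution. -/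
lemma badParts_nonempty_iff (S : Finset (Vx k m)) : (badParts S).Nonempty ↔ ¬ Full S := by
  constructor
  · rintro ⟨a, ha⟩ hfull
    obtain ⟨v, hvS, hva, hv2⟩ := hfull a
    exact hv2 (mem_badParts.mp ha v hvS hva)
  · intro h
    unfold Full at h
    push Not at h
    obtain ⟨a, ha⟩ := h
    exact ⟨a, mem_badParts.mpr ha⟩

/-- `[folklore]` auxiliary lemma `toggle_toggle` for the apex involution. -/
lemma toggle_toggle (S : Finset (Vx k m)) (x : Vx k m) : toggle (toggle S x) x = S := by
  unfold toggle
  by_cases hx : x ∈ S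
  · simp [hx, Finset.insert_erase hx]
  · simp [hx, Finset.erase_insert hx]

/-- `[folklore]` auxiliary lemma `toggle_ne` for the apex involution. -/
lemma toggle_ne (S : Finset (Vx k m)) (x : Vx k m) : toggle S x ≠ S := by
  unfold toggle
  by_cases hx : x ∈ S
  · simp only [hx, if_true]; intro h
    have hx' : x ∈ S.erase x := h.symm ▸ hx
    simp at hx'
  · simp only [hx, if_false]; intro h; rw [← h] at hx; exact hx (Finset.mem_insert_self x S)

/-- `[folklore]` auxiliary lemma `neg_one_pow_card_toggle` for the apex involution. -/
lemma neg_one_pow_card_toggle (S : Finset (Vx k m)) (x : Vx k m) :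
    (-1 : ℤ) ^ (toggle S x).card = -(-1 : ℤ) ^ S.card := by
  unfold toggle
  by_cases hx : x ∈ S
  · simp only [hx, if_true, Finset.card_erase_of_mem hx]
    obtain ⟨n, hn⟩ : ∃ n, S.card = n + 1 := Nat.exists_eq_succ_of_ne_zero (Finset.card_ne_zero_of_mem hx)
    rw [hn]; simp [pow_succ]
  · simp only [hx, if_false, Finset.card_insert_of_notMem hx, pow_succ]; ring

/-- `[folklore]` auxiliary lemma `mem_toggle_of_ne` for the apex involution. -/
lemma mem_toggle_of_ne {S : Finset (Vx k m)} {x v : Vx k m} (hvx : v ≠ x) :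
    v ∈ toggle S x ↔ v ∈ S := by
  unfold toggle
  by_cases hx : x ∈ S
  · simp [hx, hvx]
  · simp [hx, hvx]

variable {adj}

/-- `[folklore]` in a clique of a graph with independent parts, two vertices in the same part coincide -/
lemma eq_of_same_part (nopart : ∀ (a : Fin k) (i j : Fin (m + 1)), adj (a, i) (a, j) = false)
    {S : Finset (Vx k m)} (hS : IsClique adj S) {u v : Vx k m} (hu : u ∈ S) (hv : v ∈ S)
    (h : u.1 = v.1) : u = v := by
  by_contra hne
  have h1 := hS u hu v hv hne
  obtain ⟨a, i⟩ := u; obtain ⟨b, j⟩ := v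
  simp only at h; subst h
  rw [nopart] at h1; exact Bool.false_ne_true h1

/-- `[folklore]` a `Full` clique has exactly `k` vertices, none of them an apex -/
lemma card_eq_of_full (nopart : ∀ (a : Fin k) (i j : Fin (m + 1)), adj (a, i) (a, j) = false)
    {S : Finset (Vx k m)} (hS : IsClique adj S) (hF : Full S) :
    S.card = k ∧ ∀ v ∈ S, v.2 ≠ 0 := by
  have hinj : Set.InjOn Prod.fst (S : Set (Vx k m)) := fun u hu v hv h => eq_of_same_part nopart hS hu hv h
  refine ⟨?_, ?_⟩
  · have himg : S.image Prod.fst = Finset.univ := by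
      apply Finset.eq_univ_iff_forall.mpr
      intro a; obtain ⟨v, hv, hva, _⟩ := hF a
      exact Finset.mem_image.mpr ⟨v, hv, hva⟩
    have := Finset.card_image_of_injOn hinj
    rw [himg, Finset.card_univ, Fintype.card_fin] at this
    exact this.symm
  · intro v hv hv2
    obtain ⟨w, hw, hw1, hw2⟩ := hF v.1
    have : w = v := eq_of_same_part nopart hS hw hv hw1
    rw [this] at hw2; exact hw2 hv2

/-- `[folklore]` conversely a clique with `k` vertices and no apex is `Full` -/
lemma full_of_card_eq (nopart : ∀ (a : Fin k) (i j : Fin (m + 1)), adj (a, i) (a, j) = false)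
    {S : Finset (Vx k m)} (hS : IsClique adj S) (hcard : S.card = k) (hna : ∀ v ∈ S, v.2 ≠ 0) :
    Full S := by
  have hinj : Set.InjOn Prod.fst (S : Set (Vx k m)) := fun u hu v hv h => eq_of_same_part nopart hS hu hv h
  have himg : S.image Prod.fst = Finset.univ := by
    apply Finset.eq_univ_of_card
    rw [Finset.card_image_of_injOn hinj, hcard, Fintype.card_fin]
  intro a
  obtain ⟨v, hv, hva⟩ := Finset.mem_image.mp (himg ▸ Finset.mem_univ a)
  exact ⟨v, hv, hva, hna v hv⟩

/-- `[folklore]` toggling the apex of a bad part keeps a clique a clique -/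
lemma isClique_toggle (symm : ∀ u v : Vx k m, adj u v = adj v u)
    (apex : ∀ (a b : Fin k) (j : Fin (m + 1)), a ≠ b → adj (a, 0) (b, j) = true)
    {S : Finset (Vx k m)} (hS : IsClique adj S) {a : Fin k} (ha : a ∈ badParts S) :
    IsClique adj (toggle S (a, 0)) := by
  have hout : ∀ v ∈ S, v ≠ (a, 0) → v.1 ≠ a := by
    intro v hv hne hva
    have h2 := mem_badParts.mp ha v hv hva
    apply hne; obtain ⟨b, j⟩ := v; simp only at hva h2; simp [hva, h2]
  have hadj : ∀ v ∈ S, v ≠ (a, 0) → adj (a, 0) v = true := by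
    intro v hv hne
    have := hout v hv hne
    obtain ⟨b, j⟩ := v
    exact apex a b j (fun h => this h.symm)
  unfold toggle
  by_cases hx : (a, 0) ∈ S
  · simp only [hx, if_true]
    intro u hu v hv huv
    exact hS u (Finset.mem_of_mem_erase hu) v (Finset.mem_of_mem_erase hv) huv
  · simp only [hx, if_false]
    intro u hu v hv huv
    rcases Finset.mem_insert.mp hu with rfl | hu'
    · rcases Finset.mem_insert.mp hv with rfl | hv'
      · exact (huv rfl).elim
      · exact hadj v hv' (fun h => huv h.symm)
    · rcases Finset.mem_insert.mp hv with rfl | hv'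
      · rw [symm]; exact hadj u hu' huv
      · exact hS u hu' v hv' huv

/-- `[folklore]` the first bad part is unchanged by the toggle -/
lemma min_badParts_toggle {S : Finset (Vx k m)} (h : (badParts S).Nonempty) :
    ∃ h' : (badParts (toggle S ((badParts S).min' h, 0))).Nonempty,
      (badParts (toggle S ((badParts S).min' h, 0))).min' h' = (badParts S).min' h := by
  set a := (badParts S).min' h with ha_def
  have ha : a ∈ badParts S := Finset.min'_mem _ h
  -- `a` is still bad after the toggle
  have ha' : a ∈ badParts (toggle S (a, 0)) := by
    rw [mem_badParts]; intro v hv hva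
    by_cases hvx : v = (a, 0)
    · rw [hvx]
    · exact mem_badParts.mp ha v ((mem_toggle_of_ne hvx).mp hv) hva
  refine ⟨⟨a, ha'⟩, le_antisymm (Finset.min'_le _ _ ha') ?_⟩
  -- no part below `a` becomes bad
  apply Finset.le_min'
  intro b hb
  by_contra hlt; push Not at hlt
  have hbS : b ∉ badParts S := fun hbS => absurd (Finset.min'_le _ _ hbS) (not_le.mpr (ha_def ▸ hlt))
  rw [mem_badParts] at hbS; push Not at hbS
  obtain ⟨v, hv, hvb, hv2⟩ := hbS
  have hvx : v ≠ (a, 0) := by intro h; rw [h] at hv2; exact hv2 rfl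
  exact hv2 (mem_badParts.mp hb v ((mem_toggle_of_ne hvx).mpr hv) hvb)

/-- `[folklore]` auxiliary lemma `invol_invol` for the apex involution. -/
lemma invol_invol {S : Finset (Vx k m)} (h : (badParts S).Nonempty) : invol (invol S) = S := by
  obtain ⟨h', heq⟩ := min_badParts_toggle h
  unfold invol
  rw [dif_pos h, dif_pos h', heq, toggle_toggle]

/-- `[folklore]` **Proposition C** (DEQ-A07): signed clique count = `(-1)^k ·` number of full cliques. -/
theorem signed_clique_count (symm : ∀ u v : Vx k m, adj u v = adj v u)
    (nopart : ∀ (a : Fin k) (i j : Fin (m + 1)), adj (a, i) (a, j) = false)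
    (apex : ∀ (a b : Fin k) (j : Fin (m + 1)), a ≠ b → adj (a, 0) (b, j) = true) :
    (∑ S ∈ cliques adj, (-1 : ℤ) ^ S.card)
      = (-1 : ℤ) ^ k * (((cliques adj).filter Full).card : ℤ) := by
  rw [← Finset.sum_filter_add_sum_filter_not (cliques adj) Full]
  have hfull : ∑ S ∈ (cliques adj).filter Full, (-1 : ℤ) ^ S.card
      = (-1 : ℤ) ^ k * (((cliques adj).filter Full).card : ℤ) := by
    rw [Finset.sum_congr rfl (g := fun _ => (-1 : ℤ) ^ k) ?_]
    · rw [Finset.sum_const]; simp [mul_comm]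
    · intro S hS
      rw [Finset.mem_filter] at hS
      have hc : IsClique adj S := by simpa [cliques] using hS.1
      rw [(card_eq_of_full nopart hc hS.2).1]
  have hrest : ∑ S ∈ (cliques adj).filter (fun S => ¬ Full S), (-1 : ℤ) ^ S.card = 0 := by
    refine Finset.sum_involution (fun S _ => invol S) ?_ ?_ ?_ ?_
    · intro S hS
      rw [Finset.mem_filter] at hS
      have hne : (badParts S).Nonempty := (badParts_nonempty_iff S).mpr hS.2
      simp only [invol, dif_pos hne, neg_one_pow_card_toggle]; ring
    · intro S hS _
      rw [Finset.mem_filter] at hS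
      have hne : (badParts S).Nonempty := (badParts_nonempty_iff S).mpr hS.2
      simp only [invol, dif_pos hne]; exact toggle_ne S _
    · intro S hS
      rw [Finset.mem_filter] at hS ⊢
      have hc : IsClique adj S := by simpa [cliques] using hS.1
      have hne : (badParts S).Nonempty := (badParts_nonempty_iff S).mpr hS.2
      obtain ⟨h', _⟩ := min_badParts_toggle (S := S) hne
      refine ⟨?_, ?_⟩
      · simp only [cliques, Finset.mem_filter, Finset.mem_univ, true_and, invol, dif_pos hne]
        exact isClique_toggle symm apex hc (Finset.min'_mem _ hne)
      · rw [← badParts_nonempty_iff]; simp only [invol, dif_pos hne]; exact h'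
    · intro S hS
      rw [Finset.mem_filter] at hS
      exact invol_invol ((badParts_nonempty_iff S).mpr hS.2)
  rw [hfull, hrest, add_zero]

/-- `[folklore]` The full cliques are exactly the `k`-vertex cliques containing no apex. -/
theorem full_cliques_eq (nopart : ∀ (a : Fin k) (i j : Fin (m + 1)), adj (a, i) (a, j) = false) :
    (cliques adj).filter Full
      = (cliques adj).filter (fun S => S.card = k ∧ ∀ v ∈ S, v.2 ≠ 0) := by
  ext S
  simp only [Finset.mem_filter, cliques, Finset.mem_univ, true_and]
  constructor
  · rintro ⟨hc, hF⟩; exact ⟨hc, card_eq_of_full nopart hc hF⟩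
  · rintro ⟨hc, hcard, hna⟩; exact ⟨hc, full_of_card_eq nopart hc hcard hna⟩

end Involution

section Arithmetic

/-- `[folklore]` The alternating count of cliques of the complete `k`-partite graph with
parts of size `m`, written as an integer: `Σ_{j ≤ k} (-1)^(k-j) * C(k,j) * m^j = (m-1)^k`. -/
theorem alternating_clique_count_complete_multipartite (m k : ℕ) :
    (∑ j ∈ range (k + 1), (-1 : ℤ) ^ (k - j) * (k.choose j : ℤ) * (m : ℤ) ^ j)
      = ((m : ℤ) - 1) ^ k := by
  have h := add_pow ((m : ℤ)) (-1 : ℤ) k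
  -- `(m + (-1))^k = Σ_{j ≤ k} m^j * (-1)^(k-j) * C(k,j)`
  rw [show ((m : ℤ) - 1) = (m : ℤ) + (-1) by ring, h]
  refine Finset.sum_congr rfl ?_
  intro j _
  ring

/-- `[folklore]` The same identity over `ℕ` for `1 ≤ m`, in the form used for `K(m,k)`:
even-codimension cliques minus odd-codimension cliques equals `(m-1)^k`, stated as
`Σ_{j, k-j even} C(k,j) m^j = (m-1)^k + Σ_{j, k-j odd} C(k,j) m^j`. -/
theorem even_minus_odd_clique_count (m k : ℕ) (hm : 1 ≤ m) :
    (∑ j ∈ (range (k + 1)).filter (fun j => Even (k - j)), k.choose j * m ^ j)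
      = (m - 1) ^ k + ∑ j ∈ (range (k + 1)).filter (fun j => ¬ Even (k - j)), k.choose j * m ^ j := by
  have hz := alternating_clique_count_complete_multipartite m k
  have hsplit := (Finset.sum_filter_add_sum_filter_not (range (k + 1)) (fun j => Even (k - j))
    (fun j => (-1 : ℤ) ^ (k - j) * (k.choose j : ℤ) * (m : ℤ) ^ j))
  rw [← hsplit] at hz
  have he : ∀ j ∈ (range (k + 1)).filter (fun j => Even (k - j)),
      (-1 : ℤ) ^ (k - j) * (k.choose j : ℤ) * (m : ℤ) ^ j = ((k.choose j * m ^ j : ℕ) : ℤ) := by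
    intro j hj
    rw [Finset.mem_filter] at hj
    rw [hj.2.neg_one_pow]; push_cast; ring
  have ho : ∀ j ∈ (range (k + 1)).filter (fun j => ¬ Even (k - j)),
      (-1 : ℤ) ^ (k - j) * (k.choose j : ℤ) * (m : ℤ) ^ j = -((k.choose j * m ^ j : ℕ) : ℤ) := by
    intro j hj
    rw [Finset.mem_filter] at hj
    rw [(Nat.not_even_iff_odd.mp hj.2).neg_one_pow]; push_cast; ring
  rw [Finset.sum_congr rfl he, Finset.sum_congr rfl ho, Finset.sum_neg_distrib] at hz
  have hcast : (((m - 1) ^ k : ℕ) : ℤ) = ((m : ℤ) - 1) ^ k := by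
    push_cast [Nat.cast_sub hm]; ring
  have : ((∑ j ∈ (range (k + 1)).filter (fun j => Even (k - j)), k.choose j * m ^ j : ℕ) : ℤ)
      = (((m - 1) ^ k : ℕ) : ℤ) + ((∑ j ∈ (range (k + 1)).filter (fun j => ¬ Even (k - j)), k.choose j * m ^ j : ℕ) : ℤ) := by
    rw [hcast]; push_cast at hz ⊢; linarith
  exact_mod_cast this

/-- `[folklore]` Sample-count arithmetic for APEX-MC: if `T * ρ₀ * r^2 ≥ 3 * log (2/δ)` then both
multiplicative-Chernoff tails `exp(-T ρ₀ r²/3)` and `exp(-T ρ₀ r²/2)` are at most `δ/2`. -/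
theorem chernoff_budget (T ρ₀ r δ : ℝ) (hδ : 0 < δ) (hδ1 : δ ≤ 1) (hT : 3 * Real.log (2 / δ) ≤ T * ρ₀ * r ^ 2) :
    Real.exp (-(T * ρ₀ * r ^ 2) / 3) ≤ δ / 2 ∧ Real.exp (-(T * ρ₀ * r ^ 2) / 2) ≤ δ / 2 := by
  have hlog : Real.log (2 / δ) ≥ 0 := Real.log_nonneg (by rw [le_div_iff₀ hδ]; linarith)
  have h2δ : (0 : ℝ) < 2 / δ := by positivity
  constructor
  · have : -(T * ρ₀ * r ^ 2) / 3 ≤ -Real.log (2 / δ) := by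
      have := hT; linarith
    calc Real.exp (-(T * ρ₀ * r ^ 2) / 3) ≤ Real.exp (-Real.log (2 / δ)) := Real.exp_le_exp.mpr this
      _ = δ / 2 := by rw [Real.exp_neg, Real.exp_log h2δ]; field_simp
  · have : -(T * ρ₀ * r ^ 2) / 2 ≤ -Real.log (2 / δ) := by
      have := hT; nlinarith
    calc Real.exp (-(T * ρ₀ * r ^ 2) / 2) ≤ Real.exp (-Real.log (2 / δ)) := Real.exp_le_exp.mpr this
      _ = δ / 2 := by rw [Real.exp_neg, Real.exp_log h2δ]; field_simp

end Arithmetic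

end Literature.Computability.QuantumAlgorithms.ApexCliqueCount
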